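import Literature.AlgebraicGeometry.Motives.PoincareUniversal.Residual
import Literature.AlgebraicGeometry.Motives.PoincareUniversal.DualPairOfAbelianVariety
import Literature.AlgebraicGeometry.AbelianSchemes.AbelianSchemeDualTransport
import Literature.AlgebraicGeometry.AbelianSchemes.AbelianSchemeDualPairBaseChange
import Literature.AlgebraicGeometry.AbelianSchemes.AbelianSchemePolarization
import Literature.AlgebraicGeometry.AbelianSchemes.AbelianSchemeFibreFieldChange
import Literature.AlgebraicGeometry.AbelianSchemes.AbelianSchemeOverFibreDim
import Literature.AlgebraicGeometry.AbelianSchemes.AbelianSchemeOverLevelBaseChange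
import Literature.AlgebraicGeometry.Motives.AbelianVarietyConjugate
import Literature.AlgebraicGeometry.HodgeTheory.ComplexPointsLifting
import HarnessLib

/-!
# The dual abelian scheme of a polarised abelian scheme of relative dimension `g` has `g`-dimensional fibres

Layer `Literature/AlgebraicGeometry/AbelianSchemes`, namespace `Literature.AlgebraicGeometry.AbelianSchemes.AbelianSchemeOver`
(`.Polarization`, `.DualPair`).  THEOREMS ONLY (no definition, no named fact, no instance, no `sorry`).

The tree's dual pair `D = (Â, 𝒫)` of an abelian scheme `A/S` (★ `AbelianSchemeDualPair`, [MilneAV2008, I §8] /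
[MumfordFogartyKirwan1994, Cor. 6.8]) is an INTERFACE: `Â` is pinned only through the universal property, so the printed
«`dim A^∨ = dim A`» ([MumfordAV1970, §13 Cor. 3 and §8 Thm. 1]; [MilneAV2008, I §8 Rem. 8.8]) is not a field of the carrier.
This file proves it at the geometric (indeed at all field-valued) points of the base for a POLARISED abelian scheme of relative
dimension `g`, in the range where the tree holds the universal property of the complex dual (`Scheme.{0}`, residue fields
embeddable in `ℂ`):

* `Polarization.dim_hat_fibre_eq_of_complexPoint` — at a complex point `s : Spec ℂ → S`: the polarisation supplies an ample
  `Θ` on `A_s` (`Polarization.exists_ample`), ★ U-a3 (`Motives.AbelianVariety.U_a3_dualPair_ofAbelianVariety_of_residual`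
  with the ★ M13 residual `U_a3_residual_of_M13`) a SECOND dual pair of `A_s` whose dual is `A_s/K(Θ)` (★ `dualOf`), and two
  dual pairs of the same abelian scheme have isomorphic duals (★ `DualPair.hatTransportIso`, [MilneAV2008, I §8] «unique»); so
  `dim Â_s = dim (A_s/K(Θ)) = dim A_s = g` (★ `dim_dualOf`, ★ `dim_fibre_of_isOfRelDim`);
* `Polarization.dim_hat_fibre_eq_of_ringHom` / `Polarization.dim_hat_fibre_eq` — at every field-valued point over a scheme
  point whose residue field embeds in `ℂ` (the fibre at `Spec φ ≫ t` is the base change of the fibre at `t`, ★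
  `fibreFieldChangeIso`, and dimension is invariant under extension of the base field, ★ `dim_baseChangeAlong`,
  [GortzWedhorn2020, Prop. 5.38]);
* `Polarization.dim_hat_fibre_eq_of_locallyOfFiniteType` — **unconditionally** for `S` locally of finite type over a
  countable field of characteristic zero (e.g. the Siegel moduli scheme `𝓜.M → Spec ℚ`): residue fields are countable (★
  `HodgeTheory.cardinalMk_residueField_le_aleph0`) and countable fields of characteristic zero embed into `ℂ` (★
  `HodgeTheory.nonempty_ringHom_complex_of_countable`);
* transport along base change: `DualPair.dim_hat_fibre_baseChange_eq` (chosen base change, ★ `fibreBaseChangeIso`) and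
  `dim_fibre_eq_of_isBaseChangeVia` (arbitrary pull-back squares `IsBaseChangeVia`, Mathlib `IsPullback.isoPullback`).

Cell `hodgecm-mathlib` (D-0151), HECKE-LINK socket (B), brick (D1) «dim Â_s = g» (B-plan1 (g14) 22:16:52Z GO; shared input of
(u5) `exists_hatLevelStructure` — binder `hsurjn` — and (K5)); count-neutral.  HC_CM is proved only modulo the 7 printed
citations until rung 0 closes.

## References
* [MumfordAV1970] D. Mumford, *Abelian Varieties* (1970), §8 Thm. 1 (p. 77), §13 Cor. 3 (p. 130) and Thm. p. 125 (`Â = A/K(L)`).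
* [MilneAV2008] J. S. Milne, *Abelian Varieties* (v2.00, 2008), I §8 pp. 36–37 (the dual: universal property, uniqueness).
* [MumfordFogartyKirwan1994] D. Mumford, J. Fogarty, F. Kirwan, *GIT* 3rd ed. (1994), Ch. 6 §1 Cor. 6.8 (p. 118), §2 Def. 6.3 (p. 120).
* [GortzWedhorn2020] U. Görtz, T. Wedhorn, *Algebraic Geometry I* (2nd ed., 2020), Prop. 5.38 (p. 135), Section (4.7), Prop. 4.16.
-/

noncomputable section

universe u

open CategoryTheory CategoryTheory.Limits AlgebraicGeometry Cardinal

namespace Literature.AlgebraicGeometry.AbelianSchemes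

namespace AbelianSchemeOver

open Literature.AlgebraicGeometry.Motives Literature.AlgebraicGeometry.AbelianVarieties
open scoped MonObj

/-! ### §0 Dimension is invariant under isomorphism (two private conveniences) -/

/-- Isomorphic schemes have the same dimension (`Motives.schemeDim` is the topological Krull dimension, a homeomorphism
invariant; Mathlib `IsHomeomorph.topologicalKrullDim_eq`). [folklore] -/
private theorem schemeDim_eq_of_iso {X Y : Scheme.{u}} (i : X ≅ Y) : schemeDim X = schemeDim Y := by
  unfold schemeDim
  rw [IsHomeomorph.topologicalKrullDim_eq i.hom.base (TopCat.homeoOfIso (Scheme.forgetToTop.mapIso i)).isHomeomorph]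

/-- Isomorphic abelian varieties have the same dimension. [folklore] -/
private theorem dim_eq_of_iso {k : Type u} [Field k] {B C : AbelianVariety k} (e : B ≅ C) : B.dim = C.dim :=
  schemeDim_eq_of_iso
    { hom := AbelianVariety.Hom.toSchemeHom e.hom
      inv := AbelianVariety.Hom.toSchemeHom e.inv
      hom_inv_id := by
        change AbelianVariety.Hom.toSchemeHom (e.hom ≫ e.inv) = _
        rw [e.hom_inv_id]
        rfl
      inv_hom_id := by
        change AbelianVariety.Hom.toSchemeHom (e.inv ≫ e.hom) = _
        rw [e.inv_hom_id]
        rfl }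

/-! ### §1 At complex points: uniqueness of the dual pair against ★ U-a3 -/

section Complex

variable {S : Scheme.{0}} {A : AbelianSchemeOver S} {g : ℕ}

/-- **`dim Â_s = g` at a complex point** of the base of a polarised abelian scheme `A/S` of relative dimension `g` with
dual pair `D = (Â, 𝒫)`: the polarisation gives an ample `Θ` on the complex abelian variety `A_s`; ★ U-a3 makes
`(A_s/K(Θ), 𝒫_Θ)` a dual pair of `A_s` over `Spec ℂ`; the base change `(Â_s, 𝒫_s)` (★ `DualPair.baseChange`) is another;
duals of two dual pairs of one abelian scheme are isomorphic (★ `DualPair.hatTransportIso`), and `dim (A_s/K(Θ)) = dim A_s = g`.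
[cite: MumfordAV1970, §13 Cor. 3 (p. 130) and §8 Thm. 1 (p. 77)] [cite: MilneAV2008, I §8 pp. 36–37] -/
theorem Polarization.dim_hat_fibre_eq_of_complexPoint (hA : A.IsOfRelDim g) {D : A.DualPair}
    (pol : A.Polarization D) (s : Spec (.of ℂ) ⟶ S) :
    (D.hat.fibre s).toAbelianVariety.dim = g := by
  -- the complex abelian variety `A₀ = A_s` and an ample `Θ` with `λ̄ = Λ(𝒪(Θ))`
  set A₀ : AbelianVariety ℂ := (A.fibre s).toAbelianVariety with hA₀
  obtain ⟨Θ, hΘ, -⟩ := pol.exists_ample ℂ s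
  -- U-a3: a second dual pair of `A_s` whose dual is `A₀/K(Θ)`
  obtain ⟨D', e, he, -⟩ :=
    Motives.AbelianVariety.U_a3_dualPair_ofAbelianVariety_of_residual
      Motives.AbelianVariety.U_a3_residual_of_M13 A₀ Θ hΘ
  -- `ofAbelianVariety A₀ = A.baseChange s` definitionally: read `D′` as a dual pair of `A.baseChange s`
  obtain ⟨D'', e'', he''⟩ : ∃ (D'' : (A.baseChange s).DualPair)
      (e'' : D''.hat.X ≅ (AbelianSchemeOver.ofAbelianVariety (A₀.dualOf Θ hΘ)).X), IsMonHom e''.hom := ⟨D', e, he⟩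
  -- uniqueness of dual pairs: `Â″ ≅ Â_s` (★ `hatTransportIso` along `e := 𝟙`)
  haveI : IsMonHom (Iso.refl (A.baseChange s).X).hom := by
    change IsMonHom (𝟙 _); infer_instance
  let H : D''.hat.X.left ≅ (D.baseChange s).hat.X.left :=
    DualPair.hatTransportIso (D.baseChange s) D'' (Iso.refl _) (Iso.refl _) rfl
  have h1 : (D.hat.fibre s).toAbelianVariety.dim = schemeDim D''.hat.X.left := schemeDim_eq_of_iso H.symm
  have h2 : schemeDim D''.hat.X.left = (A₀.dualOf Θ hΘ).dim :=
    schemeDim_eq_of_iso ((Over.forget _).mapIso e'')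
  rw [h1, h2, Motives.AbelianVariety.dim_dualOf, hA₀]
  exact dim_fibre_of_isOfRelDim hA s

/-! ### §2 At field-valued points over scheme points whose residue field embeds in `ℂ` -/

/-- **`dim Â = g` at `Spec φ ≫ t` for any field map `φ : K → Ω`, as soon as `K` embeds in `ℂ`** (`τ : K → ℂ`): the fibres at
`Spec φ ≫ t` and `Spec τ ≫ t` are base changes of the fibre at `t` (★ `fibreFieldChangeIso`), dimension is invariant under
extension of the base field (★ `dim_baseChangeAlong`), and at the complex point `Spec τ ≫ t` §1 applies.
[cite: GortzWedhorn2020, Prop. 5.38 (p. 135)] [cite: MumfordAV1970, §13 Cor. 3 (p. 130)] -/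
theorem Polarization.dim_hat_fibre_eq_of_ringHom (hA : A.IsOfRelDim g) {D : A.DualPair} (pol : A.Polarization D)
    {K Ω : Type} [Field K] [Field Ω] (t : Spec (.of K) ⟶ S) (τ : K →+* ℂ) (φ : K →+* Ω) :
    (D.hat.fibre (Spec.map (CommRingCat.ofHom φ) ≫ t)).toAbelianVariety.dim = g := by
  have hΩ : (D.hat.fibre (Spec.map (CommRingCat.ofHom φ) ≫ t)).toAbelianVariety.dim =
      (D.hat.fibre t).toAbelianVariety.dim :=
    (dim_eq_of_iso (D.hat.fibreFieldChangeIso φ t)).symm.trans ((D.hat.fibre t).toAbelianVariety.dim_baseChangeAlong φ)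
  have hℂ : (D.hat.fibre (Spec.map (CommRingCat.ofHom τ) ≫ t)).toAbelianVariety.dim =
      (D.hat.fibre t).toAbelianVariety.dim :=
    (dim_eq_of_iso (D.hat.fibreFieldChangeIso τ t)).symm.trans ((D.hat.fibre t).toAbelianVariety.dim_baseChangeAlong τ)
  rw [hΩ, ← hℂ]
  exact pol.dim_hat_fibre_eq_of_complexPoint hA _

/-- **`dim Â_s = g` at every field-valued point `s : Spec Ω → S` over a scheme point whose residue field embeds in `ℂ`**
(`s` factors as `Spec Ω → Spec κ(s(pt)) → S`, Mathlib `Scheme.descResidueField_stalkClosedPointTo_fromSpecResidueField`).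
[cite: MumfordAV1970, §13 Cor. 3 (p. 130)] [cite: GortzWedhorn2020, Prop. 5.38 (p. 135)] -/
theorem Polarization.dim_hat_fibre_eq (hA : A.IsOfRelDim g) {D : A.DualPair} (pol : A.Polarization D)
    {Ω : Type} [Field Ω] (s : Spec (.of Ω) ⟶ S)
    (hs : Nonempty (S.residueField (s (IsLocalRing.closedPoint Ω)) →+* ℂ)) :
    (D.hat.fibre s).toAbelianVariety.dim = g := by
  obtain ⟨τ⟩ := hs
  have h := pol.dim_hat_fibre_eq_of_ringHom hA (S.fromSpecResidueField (s (IsLocalRing.closedPoint Ω))) τ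
    (S.descResidueField (Scheme.stalkClosedPointTo s)).hom
  have e : Spec.map (CommRingCat.ofHom (S.descResidueField (Scheme.stalkClosedPointTo s)).hom) ≫
      S.fromSpecResidueField (s (IsLocalRing.closedPoint Ω)) = s :=
    Scheme.descResidueField_stalkClosedPointTo_fromSpecResidueField Ω S s
  convert h using 4
  exact e.symm

/-- **`dim Â_s = g` UNCONDITIONALLY over a base locally of finite type over a countable field of characteristic zero**
(e.g. over `Spec ℚ`): the residue fields of `S` are countable (★ `HodgeTheory.cardinalMk_residueField_le_aleph0`) of
characteristic zero, hence embed into `ℂ` (★ `HodgeTheory.nonempty_ringHom_complex_of_countable`, Steinitz).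
[cite: MumfordAV1970, §13 Cor. 3 (p. 130)] [cite: MilneAV2008, I §8 pp. 36–37] -/
theorem Polarization.dim_hat_fibre_eq_of_locallyOfFiniteType (hA : A.IsOfRelDim g) {D : A.DualPair}
    (pol : A.Polarization D) {F : Type} [Field F] [CharZero F] (hF : #F ≤ ℵ₀) (f : S ⟶ Spec (.of F))
    [LocallyOfFiniteType f] {Ω : Type} [Field Ω] (s : Spec (.of Ω) ⟶ S) :
    (D.hat.fibre s).toAbelianVariety.dim = g := by
  set p : S := s (IsLocalRing.closedPoint Ω) with hp
  -- `κ(p)` is countable of characteristic zero, hence embeds into `ℂ`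
  haveI : Countable (S.residueField p) :=
    Cardinal.mk_le_aleph0_iff.mp (Literature.AlgebraicGeometry.HodgeTheory.cardinalMk_residueField_le_aleph0 S f hF p)
  let c : F →+* S.residueField p :=
    (S.evaluation ⊤ p trivial).hom.comp (f.appTop.hom.comp (Scheme.ΓSpecIso (.of F)).inv.hom)
  haveI : CharZero (S.residueField p) := (RingHom.charZero_iff c.injective).mp inferInstance
  exact pol.dim_hat_fibre_eq hA s
    (Literature.AlgebraicGeometry.HodgeTheory.nonempty_ringHom_complex_of_countable (S.residueField p))

end Complex

/-! ### §3 Transport along base change -/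

section Transport

variable {S T : Scheme.{u}}

/-- **Along the chosen base change**: if all fibres of `Â → S` have dimension `g`, so do all fibres of the dual
`Â ×_S T` of `A ×_S T` (★ `DualPair.baseChange`; the fibre of `Â ×_S T` at `t` IS the fibre of `Â` at `t ≫ f`, ★
`fibreBaseChangeIso`). [cite: MumfordFogartyKirwan1994, Ch. 6 §1 Cor. 6.8 (p. 118)] [cite: GortzWedhorn2020, Section (4.7), Prop. 4.16] -/
theorem DualPair.dim_hat_fibre_baseChange_eq {A : AbelianSchemeOver S} (D : A.DualPair) (f : T ⟶ S) {g : ℕ}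
    (hdim : ∀ ⦃Ω : Type u⦄ [Field Ω] (s : Spec (.of Ω) ⟶ S), (D.hat.fibre s).toAbelianVariety.dim = g)
    {Ω : Type u} [Field Ω] (t : Spec (.of Ω) ⟶ T) :
    ((D.baseChange f).hat.fibre t).toAbelianVariety.dim = g := by
  rw [← hdim (t ≫ f)]
  exact dim_eq_of_iso (D.hat.fibreBaseChangeIso f t)

/-- **Along an arbitrary pull-back square** `B′ → B` over `f : T → S` (★ `IsBaseChangeVia`: `G` cartesian, compatible with
the group laws): `dim B′_t = dim B_{t ≫ f}` — `B′ ≅ B ×_S T` over `T` (Mathlib `IsPullback.isoPullback`), so the fibres at `t` are isomorphic schemes, and ★ `fibreBaseChangeIso`.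
[cite: GortzWedhorn2020, Prop. 4.16 (p. 101)] [cite: MumfordFogartyKirwan1994, Ch. 7 §2 Definition 7.2 (p. 129)] -/
theorem dim_fibre_eq_of_isBaseChangeVia {B' : AbelianSchemeOver T} {B : AbelianSchemeOver S} {f : T ⟶ S}
    {G : B'.X.left ⟶ B.X.left} (h : B'.IsBaseChangeVia B f G) {Ω : Type u} [Field Ω] (t : Spec (.of Ω) ⟶ T) :
    (B'.fibre t).toAbelianVariety.dim = (B.fibre (t ≫ f)).toAbelianVariety.dim := by
  obtain ⟨-, hpb, -, -⟩ := h
  obtain ⟨-, hpb₁, -, -⟩ := B.baseChange_isBaseChangeVia f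
  -- `B′ ≅ B ×_S T` over `T` (comparison of the two cartesian squares), so the fibres at `t` are isomorphic schemes
  have hH : (hpb.isoIsPullback _ _ hpb₁).hom ≫ (B.baseChange f).X.hom = B'.X.hom := hpb.isoIsPullback_hom_snd _ _ hpb₁
  have w₁ : B'.X.hom ≫ 𝟙 T = (hpb.isoIsPullback _ _ hpb₁).hom ≫ (B.baseChange f).X.hom := by
    rw [Category.comp_id, hH]
  have w₂ : t ≫ 𝟙 T = 𝟙 _ ≫ t := by rw [Category.comp_id, Category.id_comp]
  have e₁ : (B'.fibre t).toAbelianVariety.dim = ((B.baseChange f).fibre t).toAbelianVariety.dim :=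
    schemeDim_eq_of_iso (@asIso Scheme _ _ _ _ (pullback.map_isIso (C := Scheme) _ _ _ _ _ _ _ w₁ w₂))
  rw [e₁]
  exact dim_eq_of_iso (B.fibreBaseChangeIso f t)

end Transport

end AbelianSchemeOver

end Literature.AlgebraicGeometry.AbelianSchemes
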